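import Mathlib
import Summits.KontsevichZagierPeriods.Zeta5Search.CellStarWide
import Summits.KontsevichZagierPeriods.Zeta5Search.CellBridgeWide
import Summits.KontsevichZagierPeriods.Zeta5Search.WedgeDictionaryDictBridgeWide
import Summits.KontsevichZagierPeriods.Zeta5Search.WedgeDictionaryDictStarWide
import Summits.KontsevichZagierPeriods.Zeta5Search.WedgeDictionaryBridge
import Summits.KontsevichZagierPeriods.Zeta5Search.WedgeDictionaryTerminalDescent
import HarnessLib

/-!
# The STAR-apex and BRIDGE-slot steps of the wide induction for `wedgeDictionaryFull` (cell `pub-zeta5`, seat ct-1 g23)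

HONEST FRAMING: systematic search; no irrationality claim unless certified.  Implications between displayed instances of gen-1's
dictionary statement `ExplicitPQAt` at neighbouring points of Brown–Zudilin's parameter lattice, over landed relation theorems;
no integral is evaluated, nothing about `ζ(5)`; no `def`, no new node.

The induction for the off-half-box residual of the node `wedgeDictionaryFull` (ct-1 g23, INBOX l.9031; blueprint
`HOME/ct-1/g22/WIDE-RESIDUAL.md` §5; scheme checked exhaustively on the 15,326 wide points of levels `≤ 6`, `code/scheme_check.py`)
resolves a wide point `T` (convergent, `b ≥ 0`, `d ≥ 0`, some `2b_i > N+1`), after `Σ₇`-sorting, as the solved-for member of ONE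
typed relation whose other members are earlier:
* STAR with `T` the APEX, slot pairs `(7,1)`, `(7,2)`, `(1,2)` — `explicitPQAt_apex71 / _apex72 / _apex12`: cellular side
  `CellStarWide.cellStar_wide_71/72/12` (ct-1 g23), dictionary side `dictStar_wide` (ct-1 g22), solved by the tree's `at_first_of_threeTerm`;
* BRIDGE with `T = c + e₇` the SLOT member — `explicitPQAt_bridgeSlot`: cellular side `cellBridge_wide`, dictionary side `dictBridge_wide`
  (ct-1 g23), solved by `at_of_fourTerm` after a rotation.
Also: `converges_iff_bcoords` (the seventeen forms (3) ARE `b₂, b₃ ≥ 0` and the fifteen edge-pair sums `≤ b₀`) and the membership of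
the lowered points `a − s_k` in the wide region.
-/

noncomputable section

open Finset

namespace Summit.KontsevichZagierPeriods.Zeta5Search.WedgeDictionaryWideSteps

open Summit.KontsevichZagierPeriods.Zeta5Search.WedgeDictionary
open Summit.KontsevichZagierPeriods.Zeta5Search.WedgeDictionaryDictStarWide (dictStar_wide)
open Summit.KontsevichZagierPeriods.Zeta5Search.CellStarWide (cellStar_wide_71 cellStar_wide_72 cellStar_wide_12)
open Summit.KontsevichZagierPeriods.Zeta5Search.CellBridgeWide (cellBridge_wide)
open Summit.KontsevichZagierPeriods.Zeta5Search.Elimination (dictBridge_wide)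
open Literature.NumberTheory.Irrationality.BrownZudilin2022 (bOfA Converges QOf cellularIntegral convergenceForms)

/-! ## 1. Rotations of the transfer lemmas -/

/-- Solve a four-term relation for its SECOND member. [folklore] -/
theorem at_second_of_fourTerm {α β γ δ : ℚ} {a₀ a₁ a₂ a₃ : Fin 8 → ℤ} {j₀ j₁ j₂ j₃ : ℕ}
    (hrel : FourTermRel α β γ δ a₀ a₁ a₂ a₃) (hd : DictFourTerm α β γ δ a₀ a₁ a₂ a₃ j₀ j₁ j₂ j₃)
    (h₀ : ExplicitPQAt a₀ j₀) (h₂ : ExplicitPQAt a₂ j₂) (h₃ : ExplicitPQAt a₃ j₃) (hβ : β ≠ 0) : ExplicitPQAt a₁ j₁ := by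
  have hrel' : FourTermRel γ δ α β a₂ a₃ a₀ a₁ := by
    unfold FourTermRel at hrel ⊢; linarith
  have hd' : DictFourTerm γ δ α β a₂ a₃ a₀ a₁ j₂ j₃ j₀ j₁ := by
    obtain ⟨h1, h2, h3⟩ := hd
    exact ⟨by linarith, by linarith, by linarith⟩
  exact at_of_fourTerm hrel' hd' h₂ h₃ h₀ hβ

/-! ## 2. The seventeen forms in dual coordinates; lowering a slot stays in the wide region -/

/-- **The convergence cone in dual coordinates**: the seventeen forms (3) are `b₂`, `b₃` and the fifteen edge-pair complements
`b₀ − b_j − b_k`, `(j,k) ∈ E`. [folklore] -/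
theorem converges_iff_bcoords (a : Fin 8 → ℤ) : Converges a ↔
    (0 ≤ bOfA a 2 ∧ 0 ≤ bOfA a 3 ∧
      bOfA a 1 + bOfA a 2 ≤ bOfA a 0 ∧ bOfA a 1 + bOfA a 3 ≤ bOfA a 0 ∧ bOfA a 1 + bOfA a 4 ≤ bOfA a 0 ∧
      bOfA a 1 + bOfA a 5 ≤ bOfA a 0 ∧ bOfA a 2 + bOfA a 3 ≤ bOfA a 0 ∧ bOfA a 2 + bOfA a 4 ≤ bOfA a 0 ∧
      bOfA a 2 + bOfA a 5 ≤ bOfA a 0 ∧ bOfA a 2 + bOfA a 6 ≤ bOfA a 0 ∧ bOfA a 3 + bOfA a 4 ≤ bOfA a 0 ∧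
      bOfA a 3 + bOfA a 6 ≤ bOfA a 0 ∧ bOfA a 3 + bOfA a 7 ≤ bOfA a 0 ∧ bOfA a 4 + bOfA a 7 ≤ bOfA a 0 ∧
      bOfA a 5 + bOfA a 6 ≤ bOfA a 0 ∧ bOfA a 5 + bOfA a 7 ≤ bOfA a 0 ∧ bOfA a 6 + bOfA a 7 ≤ bOfA a 0) := by
  unfold Converges
  simp only [convergenceForms, List.mem_cons, List.not_mem_nil, or_false, forall_eq_or_imp, forall_eq, bOfA]
  constructor
  · rintro ⟨f0, f1, f2, f3, f4, f5, f6, f7, f8, f9, f10, f11, f12, f13, f14, f15, f16⟩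
    refine ⟨?_, ?_, ?_, ?_, ?_, ?_, ?_, ?_, ?_, ?_, ?_, ?_, ?_, ?_, ?_, ?_, ?_⟩ <;> omega
  · rintro ⟨f0, f1, f2, f3, f4, f5, f6, f7, f8, f9, f10, f11, f12, f13, f14, f15, f16⟩
    refine ⟨?_, ?_, ?_, ?_, ?_, ?_, ?_, ?_, ?_, ?_, ?_, ?_, ?_, ?_, ?_, ?_, ?_⟩ <;> omega

/-- **Lowering a positive slot stays in the wide region**: if `a` is convergent with `b(a) ≥ 0`, `d ≥ 0` and `b_k ≥ 1`
(`k ∈ [1,7]`), then `a − s_k` is convergent with `b ≥ 0` and `d ≥ 0` (`d` goes up by one). [folklore] -/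
theorem wide_add_slotDown {a : Fin 8 → ℤ} {k : ℕ} (hk : k ∈ Icc 1 7) (hconv : Converges a)
    (hnn : ∀ m ∈ Icc 1 7, 0 ≤ bOfA a m) (hd : 0 ≤ dOf (bOfA a)) (h1 : 1 ≤ bOfA a k) :
    Converges (a + slotDown k) ∧ (∀ m ∈ Icc 1 7, 0 ≤ bOfA (a + slotDown k) m) ∧ 0 ≤ dOf (bOfA (a + slotDown k)) := by
  have hb : ∀ n, n ≤ 7 → bOfA (a + slotDown k) n = if n = k then bOfA a n - 1 else bOfA a n :=
    fun n hn => bOfA_add_slotDown a k hk n hn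
  have e0 := hb 0 (by norm_num); have e1 := hb 1 (by norm_num); have e2 := hb 2 (by norm_num)
  have e3 := hb 3 (by norm_num); have e4 := hb 4 (by norm_num); have e5 := hb 5 (by norm_num)
  have e6 := hb 6 (by norm_num); have e7 := hb 7 (by norm_num)
  have n1 := hnn 1 (by simp); have n2 := hnn 2 (by simp); have n3 := hnn 3 (by simp); have n4 := hnn 4 (by simp)
  have n5 := hnn 5 (by simp); have n6 := hnn 6 (by simp); have n7 := hnn 7 (by simp)
  obtain ⟨c2, c3, p12, p13, p14, p15, p23, p24, p25, p26, p34, p36, p37, p47, p56, p57, p67⟩ :=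
    (converges_iff_bcoords a).1 hconv
  obtain ⟨hk1, hk7⟩ := mem_Icc.1 hk
  refine ⟨?_, fun m hm => ?_, ?_⟩
  · rw [converges_iff_bcoords]
    interval_cases k <;> norm_num at e0 e1 e2 e3 e4 e5 e6 e7 <;> rw [e0, e1, e2, e3, e4, e5, e6, e7] <;> omega
  · rw [hb m (mem_Icc.1 hm).2]
    split_ifs with h
    · subst h; omega
    · exact hnn m hm
  · unfold dOf at hd ⊢
    simp only [sum_range_succ, sum_range_zero, zero_add, Nat.reduceAdd] at hd ⊢
    rw [e0, e1, e2, e3, e4, e5, e6, e7, if_neg (show (0 : ℕ) ≠ k by omega)]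
    split_ifs <;> omega

/-! ## 3. STAR with the target as apex -/

/-- **STAR-apex step, slots `(7,1)`**: for a wide point `a` with `b₁, b₇ ≥ 1`, `b₁ + 1 ≤ b₀` and
`κ = (b₇ − b₁)(b₀ + 1 − b₇ − b₁) ≠ 0`, `ExplicitPQAt` at `a − s₁` and `a − s₇` (any partners) gives `ExplicitPQAt a j`. [folklore] -/
theorem explicitPQAt_apex71 {a : Fin 8 → ℤ} {j j₁ j₂ : ℕ} (hj : j ∈ Icc 1 7) (hj₁ : j₁ ∈ Icc 1 7) (hj₂ : j₂ ∈ Icc 1 7)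
    (hconv : Converges a) (hnn : ∀ m ∈ Icc 1 7, 0 ≤ bOfA a m) (hd : 0 ≤ dOf (bOfA a))
    (h1 : 1 ≤ bOfA a 1) (h7 : 1 ≤ bOfA a 7) (hkN : bOfA a 1 + 1 ≤ bOfA a 0) (hκ : starKappa (bOfA a) 7 1 ≠ 0)
    (E1 : ExplicitPQAt (a + slotDown 1) j₁) (E7 : ExplicitPQAt (a + slotDown 7) j₂) : ExplicitPQAt a j := by
  obtain ⟨c1, n1, d1⟩ := wide_add_slotDown (show 1 ∈ Icc 1 7 by simp) hconv hnn hd h1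
  obtain ⟨c7, n7, d7⟩ := wide_add_slotDown (show 7 ∈ Icc 1 7 by simp) hconv hnn hd h7
  have hrel := cellStar_wide_71 a hconv c1 c7
  have hdic := dictStar_wide a 7 1 j j₁ j₂ (by simp) (by simp) (by norm_num) hj hj₁ hj₂ hconv hnn hd c1 n1 d1 c7 n7 d7 hkN
  have hκ' : (starKappa (bOfA a) 7 1 : ℚ) ≠ 0 := by exact_mod_cast hκ
  exact at_first_of_threeTerm hrel hdic E1 E7 hκ'

/-- **STAR-apex step, slots `(7,2)`.** [folklore] -/
theorem explicitPQAt_apex72 {a : Fin 8 → ℤ} {j j₁ j₂ : ℕ} (hj : j ∈ Icc 1 7) (hj₁ : j₁ ∈ Icc 1 7) (hj₂ : j₂ ∈ Icc 1 7)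
    (hconv : Converges a) (hnn : ∀ m ∈ Icc 1 7, 0 ≤ bOfA a m) (hd : 0 ≤ dOf (bOfA a))
    (h2 : 1 ≤ bOfA a 2) (h7 : 1 ≤ bOfA a 7) (hkN : bOfA a 2 + 1 ≤ bOfA a 0) (hκ : starKappa (bOfA a) 7 2 ≠ 0)
    (E2 : ExplicitPQAt (a + slotDown 2) j₁) (E7 : ExplicitPQAt (a + slotDown 7) j₂) : ExplicitPQAt a j := by
  obtain ⟨c2, n2, d2⟩ := wide_add_slotDown (show 2 ∈ Icc 1 7 by simp) hconv hnn hd h2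
  obtain ⟨c7, n7, d7⟩ := wide_add_slotDown (show 7 ∈ Icc 1 7 by simp) hconv hnn hd h7
  have hrel := cellStar_wide_72 a hconv c2 c7
  have hdic := dictStar_wide a 7 2 j j₁ j₂ (by simp) (by simp) (by norm_num) hj hj₁ hj₂ hconv hnn hd c2 n2 d2 c7 n7 d7 hkN
  have hκ' : (starKappa (bOfA a) 7 2 : ℚ) ≠ 0 := by exact_mod_cast hκ
  exact at_first_of_threeTerm hrel hdic E2 E7 hκ'

/-- **STAR-apex step, slots `(1,2)`.** [folklore] -/
theorem explicitPQAt_apex12 {a : Fin 8 → ℤ} {j j₁ j₂ : ℕ} (hj : j ∈ Icc 1 7) (hj₁ : j₁ ∈ Icc 1 7) (hj₂ : j₂ ∈ Icc 1 7)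
    (hconv : Converges a) (hnn : ∀ m ∈ Icc 1 7, 0 ≤ bOfA a m) (hd : 0 ≤ dOf (bOfA a))
    (h2 : 1 ≤ bOfA a 2) (h1 : 1 ≤ bOfA a 1) (hkN : bOfA a 2 + 1 ≤ bOfA a 0) (hκ : starKappa (bOfA a) 1 2 ≠ 0)
    (E2 : ExplicitPQAt (a + slotDown 2) j₁) (E1 : ExplicitPQAt (a + slotDown 1) j₂) : ExplicitPQAt a j := by
  obtain ⟨c2, n2, d2⟩ := wide_add_slotDown (show 2 ∈ Icc 1 7 by simp) hconv hnn hd h2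
  obtain ⟨c1, n1, d1⟩ := wide_add_slotDown (show 1 ∈ Icc 1 7 by simp) hconv hnn hd h1
  have hrel := cellStar_wide_12 a hconv c2 c1
  have hdic := dictStar_wide a 1 2 j j₁ j₂ (by simp) (by simp) (by norm_num) hj hj₁ hj₂ hconv hnn hd c2 n2 d2 c1 n1 d1 hkN
  have hκ' : (starKappa (bOfA a) 1 2 : ℚ) ≠ 0 := by exact_mod_cast hκ
  exact at_first_of_threeTerm hrel hdic E2 E1 hκ'

/-! ## 4. BRIDGE with the target as the slot member -/

/-- **BRIDGE-slot step**: the target `t` is `c + e₇` for the base `a_c = t − s₇`... in `a`-coordinates `a_c = t + slotDown 7`.  If the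
base `a_c`, the target `t`, the half-shifted point `a_c + e₁ + e₃` and the apex `a_c + DS` are wide points, `c₁ + c₆ ≤ c₀` at `c = b(a_c)`,
`bridgeSlot(c) ≠ 0`, and `ExplicitPQAt` holds at the base, the half-shifted point and the apex, then `ExplicitPQAt t j`. [folklore] -/
theorem explicitPQAt_bridgeSlot {t : Fin 8 → ℤ} {j j₀ j₂ j₃ : ℕ} (hj : j ∈ Icc 1 7) (hj₀ : j₀ ∈ Icc 1 7) (hj₂ : j₂ ∈ Icc 1 7)
    (hj₃ : j₃ ∈ Icc 1 7)
    (hct : Converges t) (hnt : ∀ m ∈ Icc 1 7, 0 ≤ bOfA t m) (hdt : 0 ≤ dOf (bOfA t))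
    (hc₀ : Converges (t + slotDown 7)) (hn₀ : ∀ m ∈ Icc 1 7, 0 ≤ bOfA (t + slotDown 7) m) (hd₀ : 0 ≤ dOf (bOfA (t + slotDown 7)))
    (hc₂ : Converges (t + slotDown 7 + halfUp457)) (hn₂ : ∀ m ∈ Icc 1 7, 0 ≤ bOfA (t + slotDown 7 + halfUp457) m)
    (hd₂ : 0 ≤ dOf (bOfA (t + slotDown 7 + halfUp457)))
    (hc₃ : Converges (t + slotDown 7 + dsUp)) (hn₃ : ∀ m ∈ Icc 1 7, 0 ≤ bOfA (t + slotDown 7 + dsUp) m)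
    (hd₃ : 0 ≤ dOf (bOfA (t + slotDown 7 + dsUp)))
    (h16 : bOfA (t + slotDown 7) 1 + bOfA (t + slotDown 7) 6 ≤ bOfA (t + slotDown 7) 0)
    (hβ : bridgeSlot (bOfA (t + slotDown 7)) ≠ 0)
    (E₀ : ExplicitPQAt (t + slotDown 7) j₀) (E₂ : ExplicitPQAt (t + slotDown 7 + halfUp457) j₂)
    (E₃ : ExplicitPQAt (t + slotDown 7 + dsUp) j₃) : ExplicitPQAt t j := by
  have e : t + slotDown 7 - slotDown 7 = t := add_sub_cancel_right t (slotDown 7)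
  have hc₁ : Converges (t + slotDown 7 - slotDown 7) := by rw [e]; exact hct
  have hn₁ : ∀ m ∈ Icc 1 7, 0 ≤ bOfA (t + slotDown 7 - slotDown 7) m := by rw [e]; exact hnt
  have hd₁ : 0 ≤ dOf (bOfA (t + slotDown 7 - slotDown 7)) := by rw [e]; exact hdt
  have hrel := cellBridge_wide (t + slotDown 7) hc₀ hc₁ hc₂ hc₃
  have hdic := dictBridge_wide (t + slotDown 7) j₀ j j₂ j₃ hj₀ hj hj₂ hj₃ hc₀ hn₀ hd₀ hc₁ hn₁ hd₁ hc₂ hn₂ hd₂ hc₃ hn₃ hd₃ h16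
  rw [e] at hrel hdic
  have hβ' : (bridgeSlot (bOfA (t + slotDown 7)) : ℚ) ≠ 0 := by exact_mod_cast hβ
  exact at_second_of_fourTerm hrel hdic E₀ E₂ E₃ hβ'

end Summit.KontsevichZagierPeriods.Zeta5Search.WedgeDictionaryWideSteps

end
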